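import Literature.NumberTheory.EllipticCurves.PadicSigmaOfZetaProofs
import Literature.NumberTheory.EllipticCurves.PadicWeierstrassZetaApproximants
import Literature.NumberTheory.EllipticCurves.FormalGroupDenominators
import Literature.NumberTheory.EllipticCurves.FormalGroupShortModelParityProofs
import Mathlib.RingTheory.PowerSeries.Substitution
import Mathlib.RingTheory.PowerSeries.Derivative
import HarnessLib

/-!
# The functional equation of the sigma series along an isogeny of Frobenius type
# (Blakestad–Grant 2023, Prop. 13, in cleared power-series form; proofs only)

Trunk T-NT-EC (Literature/NumberTheory/EllipticCurves). Step F5b of the programme towards the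
tree's named fact `WeierstrassCurve.mazur_tate_sigma_existsUnique` (Mazur–Stein–Tate 2006,
Thm. 1.3) along Blakestad–Grant's proof of their Thm. 1 (`PadicSigmaOfZetaProofs.lean` reduces
the fact to the `p`-integrality of `exp g`, `g = ∫ζ̃ω`; `VeluKernelReductionProofs.lean` gives
the isogeny `ψ : E → E'' = E/C` by a canonical-type kernel, `E''` a Frobenius twist modulo `p`,
with its formal power series `t_p = tΦu`, `u ≡ 1 (mod p)`).

Here we prove Blakestad–Grant's **Prop. 13** — the functional equation
`g(t) - p⁻¹g''(t') = p⁻¹ log u(t)` — as pure power-series calculus over a `ℚ`-algebra `A`, in the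
form (`derivative_functionalEquation`)

  **`d/dt (p·g - g''∘τ) = u'/u`,   `(p·g - g''∘τ)(0) = 0`,**

where `g = W.sigmaExpArg Λ`, `g'' = W''.sigmaExpArg Λ''` are the `g`-series of two short curves
with zeta data `(β, Λ)`, `(β'', Λ'')` (`zΛ' - Λ = -(X - βz²)W`, Blakestad–Grant Thm. 2,
`PadicWeierstrassZetaProofs.lean`), and `τ = t' = γ·t·𝒟·u` (`γ = p/ℓ₀`) is the formal isogeny,
from the three identities describing `ψ` at the formal point:

* (V1) `X''(τ) = u²·𝒰` — the `x`-coordinate of `ψ(T)` (`x'' = ℓ₀²U/φ²`);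
* (V2) `W''(τ)·τ' = γ·W` — `ψ^*ω'' = γω`;
* (HL) `t·C' - C = W·(pX - T't² - 𝒰/𝒟²)` for `C = t·D log D(x(t)) = 𝒟_{2n}(𝒟)/𝒟` — Lemma 10
  summed over the kernel (`U/D² = px - D² log D(x) - T'`, `VeluLogDerivativeProofs.lean`),

together with the integrality hypotheses under which Blakestad–Grant's constant `η`
(eq. (9)) vanishes: the curves, `Λ, Λ'', 𝒟` and `u = 1 + pu₁` come from a subring `O` (given as a
ring `O → A`) which is `p`-adically separated and in which the Hasse coefficients `w_{p^k-1}` are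
units, and `Λ, Λ'', 𝒟, u` are even.

Proof (Blakestad–Grant, proof of Prop. 13, made formal): with `A(t) = tζ''(τ) = Λ''(τ)/v`
(`τ = tv`), `B = tζ = Λ`, `C = t·D log D(x(t))`: `tA' - A = -γW(X''(τ) - β''τ²)/v²`,
`tB' - B = -(X - βt²)W`, `tC' - C = (HL)`, so `tδ := A - ℓ₀B - γ⁻¹C` satisfies `tδ(0) = 0` and
`t(tδ)' - tδ = η₀t²W`, `η₀ = γβ'' - ℓ₀β + T'/γ` (`derivative_identity`); hence `δ = tδ/t` has
`δ' = η₀W`, `δ = η₀ log_E + δ(0)`, `δ(0) = 0` by parity; on the other hand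
`δ = ζ̃''(τ) - ℓ₀ζ̃ + (ℓ₀/p)·D u/u` has coefficients in `O` (`eps_eq_integral_form`), so
`η₀w_{p^k-1}/p^k ∈ O` for all `k`, forcing `η₀ = 0` (`eta0_eq_zero`; the divisor-free form of
Blakestad–Grant's Lemma 4 / eq. (9)); finally `δ = 0` turns `t(p g - g''∘τ)'` into `tu'/u`.

## Sources

* C. Blakestad, D. Grant, J. Number Theory 249 (2023) (arXiv:1903.02480), §2.3: Prop. 13 (a),(b)
  and its proof (eqs. (7)–(9)), Cor. 9, Lemma 4, Lemma 12. [BlakestadGrant2023]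
* B. Mazur, W. Stein, J. Tate, Doc. Math. Extra Vol. Coates (2006), Thm. 1.3. [MazurSteinTate2006]

Pure proof file: no definitions (the series `A`, `C`, `tδ` are abbreviations inside proofs), no
named facts.
-/

noncomputable section

open PowerSeries Literature.NumberTheory.EllipticCurves

namespace WeierstrassCurve

/-! ### Power-series calculus over a `ℚ`-algebra -/

section Calculus

variable {A : Type*} [CommRing A] [Algebra ℚ A]

/-- Two series with the same derivative and the same constant term are equal (`ℚ`-algebra).
[folklore] -/
theorem _root_.Literature.NumberTheory.EllipticCurves.eq_of_derivative_eq {f g : A⟦X⟧}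
    (hd : d⁄dX A f = d⁄dX A g) (h0 : constantCoeff f = constantCoeff g) : f = g := by
  ext n
  rcases n with _ | n
  · simpa only [coeff_zero_eq_constantCoeff] using h0
  · have h := congrArg (coeff n) hd
    rw [coeff_derivative, coeff_derivative] at h
    have hn : (algebraMap ℚ A (n + 1 : ℚ)) * algebraMap ℚ A (1 / (n + 1 : ℚ)) = 1 := by
      rw [← map_mul, mul_one_div_cancel (Nat.cast_add_one_ne_zero n), map_one]
    have hcast : ((n : A) + 1) = algebraMap ℚ A (n + 1 : ℚ) := by
      rw [map_add, map_natCast, map_one]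
    calc coeff (n + 1) f = coeff (n + 1) f * ((n : A) + 1) * algebraMap ℚ A (1 / (n + 1 : ℚ)) := by
          rw [mul_assoc, hcast, hn, mul_one]
      _ = coeff (n + 1) g * ((n : A) + 1) * algebraMap ℚ A (1 / (n + 1 : ℚ)) := by rw [h]
      _ = coeff (n + 1) g := by rw [mul_assoc, hcast, hn, mul_one]

variable (W : WeierstrassCurve A)

/-- **`ε' = c·ω ⇒ ε = c·log_W + ε(0)`** (integration against the invariant differential;
`log_W' = ω`). [Silverman AEC IV.5 (`log = ∫ω`)] [folklore] -/
theorem eq_C_mul_formalLog_add_of_derivative_eq {ε : A⟦X⟧} {c : A} (h : d⁄dX A ε = C c * W.formalOmega) :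
    ε = C c * W.formalLog + C (constantCoeff ε) := by
  refine eq_of_derivative_eq ?_ ?_
  · rw [map_add, derivative_C, add_zero, Derivation.leibniz, derivative_C, smul_zero, add_zero, smul_eq_mul,
      W.derivative_formalLog, h]
  · rw [map_add, map_mul, W.constantCoeff_formalLog, mul_zero, zero_add, constantCoeff_C]

end Calculus

/-! ### Blakestad–Grant's `δ`: `t(tδ)' - tδ = η₀t²W` -/

section Delta

variable {A : Type*} [CommRing A] [Algebra ℚ A]

omit [Algebra ℚ A] in
/-- Derivative of the inverse of a unit series: `(v⁻¹)' = -v'·v⁻²`. [folklore] -/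
theorem _root_.Literature.NumberTheory.EllipticCurves.derivative_invOfUnit_eq {v : A⟦X⟧} {γu : Aˣ}
    (hv : constantCoeff v = γu) :
    d⁄dX A (v.invOfUnit γu) = -d⁄dX A v * v.invOfUnit γu ^ 2 := by
  have h1 : v * v.invOfUnit γu = 1 := PowerSeries.mul_invOfUnit v γu hv
  have h2 := congrArg (d⁄dX A) h1
  rw [Derivation.leibniz, Derivation.map_one_eq_zero, smul_eq_mul, smul_eq_mul] at h2
  linear_combination (v.invOfUnit γu) * h2 - d⁄dX A (v.invOfUnit γu) * h1

variable (W W₂ : WeierstrassCurve A)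

omit [Algebra ℚ A] in
/-- **`t·A' - A = -γ·W·(X''(τ) - β''τ²)/v²` for `A = tζ''(τ) = Λ''(τ)/v`** (`τ = t·v`): the zeta
equation of `E''` pulled back along the formal isogeny, using `ψ^*ω'' = γω` (V2) and the
`x`-coordinate of `ψ(T)` (V1). This is the first line of Blakestad–Grant's computation (7)–(8)
(`D(ζ_{E'}(t')) = (H/p)⁻¹D'ζ_{E'} = …`). [Blakestad–Grant 2023, proof of Prop. 13]
[cite: BlakestadGrant2023, Prop. 13] -/
theorem X_mul_derivative_Aser_sub {γ β₂ : A} (hγ : IsUnit γ) {𝒟c u 𝒰 Λ₂ : A⟦X⟧}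
    (h𝒟c0 : constantCoeff 𝒟c = 1) (hu0 : constantCoeff u = 1)
    (hΛ₂ : X * d⁄dX A Λ₂ - Λ₂ = -((W₂.formalXMulSq - C β₂ * X ^ 2) * W₂.formalInvDiff))
    (hV1 : W₂.formalXMulSq.subst (X * (C γ * 𝒟c * u)) = u ^ 2 * 𝒰)
    (hV2 : W₂.formalInvDiff.subst (X * (C γ * 𝒟c * u)) * d⁄dX A (X * (C γ * 𝒟c * u)) = C γ * W.formalInvDiff) :
    let v := C γ * 𝒟c * u
    let vinv := v.invOfUnit hγ.unit
    let Aser := Λ₂.subst (X * v) * vinv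
    X * d⁄dX A Aser - Aser = -(C γ * W.formalInvDiff) * (u ^ 2 * 𝒰 - C β₂ * (X * v) ^ 2) * vinv ^ 2 := by
  intro v vinv Aser
  have hv0 : constantCoeff v = hγ.unit := by
    show constantCoeff (C γ * 𝒟c * u) = _
    rw [map_mul, map_mul, constantCoeff_C, h𝒟c0, hu0, mul_one, mul_one, IsUnit.unit_spec]
  have hvv : v * vinv = 1 := PowerSeries.mul_invOfUnit v _ hv0
  have hτ0 : constantCoeff (X * v) = 0 := by rw [map_mul, constantCoeff_X, zero_mul]
  have hτ : HasSubst (X * v) := HasSubst.of_constantCoeff_zero' hτ0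
  set τ := X * v with hτdef
  set L := Λ₂.subst τ with hL
  set Lp := (d⁄dX A Λ₂).subst τ with hLp
  -- the zeta equation of `E''`, substituted
  have E1 : τ * Lp - L = -((W₂.formalXMulSq.subst τ - C β₂ * τ ^ 2) * W₂.formalInvDiff.subst τ) := by
    have h := congrArg (PowerSeries.subst τ) hΛ₂
    rw [subst_sub hτ, subst_mul hτ, subst_X hτ, ← coe_substAlgHom hτ, map_neg, map_mul, map_sub, map_mul,
      map_pow, coe_substAlgHom hτ, subst_C, subst_X hτ] at h
    exact h
  have E2 : d⁄dX A L = Lp * d⁄dX A τ := derivative_subst A hτ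
  have E3 : d⁄dX A τ = v + X * d⁄dX A v := by
    rw [hτdef, Derivation.leibniz, derivative_X, smul_eq_mul, smul_eq_mul, mul_one, add_comm]
  -- `v·(XL' ) - XLv' - vL = -(X''(τ) - β''τ²)·γW`
  have key : v * (X * d⁄dX A L) - X * L * d⁄dX A v - v * L =
      -((u ^ 2 * 𝒰 - C β₂ * τ ^ 2) * (C γ * W.formalInvDiff)) := by
    linear_combination (v * X) * E2 + d⁄dX A τ * E1 + L * E3 -
      (W₂.formalXMulSq.subst τ - C β₂ * τ ^ 2) * hV2 - (C γ * W.formalInvDiff) * hV1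
  have hvinv' := derivative_invOfUnit_eq hv0
  show X * d⁄dX A (L * vinv) - L * vinv = -(C γ * W.formalInvDiff) * (u ^ 2 * 𝒰 - C β₂ * τ ^ 2) * vinv ^ 2
  rw [Derivation.leibniz, smul_eq_mul, smul_eq_mul, hvinv']
  linear_combination vinv ^ 2 * key - (X * d⁄dX A L - L) * vinv * hvv

omit [Algebra ℚ A] in
/-- **Blakestad–Grant's `δ`, cleared: `t·(tδ)' - tδ = η₀·t²·W` and `(tδ)(0) = 0`**, where
`tδ = tζ''(τ) - ℓ₀·tζ - γ⁻¹·t·D log D(x(t))` (`tζ = Λ`, `t·D log D(x(t)) = 𝒟_{2n}(𝒟)/𝒟`,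
`ℓ₀ = p/γ`) and **`η₀ = γβ'' - ℓ₀β + T'/γ`** is their constant `η` of (9)
(`(p/H)β' + (H/p)(T'(x) - pβ)`; our `β`'s are the negatives of the Mazur–Tate constants and
`γ = p/H`). Ingredients: `X_mul_derivative_Aser_sub`, the zeta equation of `E`, and the summed
Lemma 10 (HL). [Blakestad–Grant 2023, proof of Prop. 13, eqs. (7)–(9)]
[cite: BlakestadGrant2023, Prop. 13] -/
theorem X_mul_derivative_tdelta_sub {γ ℓ₀ β β₂ T' : A} (hγ : IsUnit γ) {p n : ℕ} (hp : 2 * n + 1 = p)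
    (hγℓ : γ * ℓ₀ = p) {𝒟c u 𝒰 Λ Λ₂ : A⟦X⟧}
    (h𝒟c0 : constantCoeff 𝒟c = 1) (hu0 : constantCoeff u = 1) (hΛ0 : constantCoeff Λ = 1)
    (hΛ₂0 : constantCoeff Λ₂ = 1)
    (hΛ : X * d⁄dX A Λ - Λ = -((W.formalXMulSq - C β * X ^ 2) * W.formalInvDiff))
    (hΛ₂ : X * d⁄dX A Λ₂ - Λ₂ = -((W₂.formalXMulSq - C β₂ * X ^ 2) * W₂.formalInvDiff))
    (hV1 : W₂.formalXMulSq.subst (X * (C γ * 𝒟c * u)) = u ^ 2 * 𝒰)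
    (hV2 : W₂.formalInvDiff.subst (X * (C γ * 𝒟c * u)) * d⁄dX A (X * (C γ * 𝒟c * u)) = C γ * W.formalInvDiff)
    (hHL : X * d⁄dX A (W.clearedDeriv (2 * n) 𝒟c * 𝒟c.invOfUnit 1) - W.clearedDeriv (2 * n) 𝒟c * 𝒟c.invOfUnit 1 =
      W.formalInvDiff * (C (p : A) * W.formalXMulSq - C T' * X ^ 2 - 𝒰 * 𝒟c.invOfUnit 1 ^ 2)) :
    let v := C γ * 𝒟c * u
    let tδ := Λ₂.subst (X * v) * v.invOfUnit hγ.unit - C ℓ₀ * Λ -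
      C (↑hγ.unit⁻¹ : A) * (W.clearedDeriv (2 * n) 𝒟c * 𝒟c.invOfUnit 1)
    X * d⁄dX A tδ - tδ = C (γ * β₂ - ℓ₀ * β + T' * ↑hγ.unit⁻¹) * X ^ 2 * W.formalInvDiff ∧
      constantCoeff tδ = 0 := by
  intro v tδ
  have hA : X * d⁄dX A (Λ₂.subst (X * v) * v.invOfUnit hγ.unit) - Λ₂.subst (X * v) * v.invOfUnit hγ.unit =
      -(C γ * W.formalInvDiff) * (u ^ 2 * 𝒰 - C β₂ * (X * v) ^ 2) * v.invOfUnit hγ.unit ^ 2 :=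
    W.X_mul_derivative_Aser_sub W₂ hγ h𝒟c0 hu0 hΛ₂ hV1 hV2
  set γinv : A := ↑hγ.unit⁻¹ with hγinv
  set vinv := v.invOfUnit hγ.unit with hvinvdef
  set 𝒟cinv := 𝒟c.invOfUnit 1 with h𝒟cinvdef
  set Cc := W.clearedDeriv (2 * n) 𝒟c * 𝒟cinv with hCc
  have hγγ : γ * γinv = 1 := by rw [hγinv, IsUnit.mul_val_inv]
  have hCγ : C γ * C γinv = (1 : A⟦X⟧) := by rw [← map_mul, hγγ, map_one]
  have hℓ : ℓ₀ = γinv * p := by rw [← hγℓ, ← mul_assoc, mul_comm γinv, hγγ, one_mul]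
  have hv0 : constantCoeff v = hγ.unit := by
    show constantCoeff (C γ * 𝒟c * u) = _
    rw [map_mul, map_mul, constantCoeff_C, h𝒟c0, hu0, mul_one, mul_one, IsUnit.unit_spec]
  have hvv : v * vinv = 1 := PowerSeries.mul_invOfUnit v _ hv0
  have h𝒟𝒟 : 𝒟c * 𝒟cinv = 1 := PowerSeries.mul_invOfUnit 𝒟c 1 (by rw [h𝒟c0, Units.val_one])
  have hτ0 : constantCoeff (X * v) = 0 := by rw [map_mul, constantCoeff_X, zero_mul]
  -- `γ·u²/v² = γ⁻¹/𝒟²`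
  have hstar : C γ * u ^ 2 * vinv ^ 2 = C γinv * 𝒟cinv ^ 2 := by
    have hvu : IsUnit (v ^ 2) := by
      refine IsUnit.pow 2 (PowerSeries.isUnit_iff_constantCoeff.mpr ?_)
      rw [hv0]; exact Units.isUnit _
    refine hvu.mul_left_cancel ?_
    have hv : v = C γ * 𝒟c * u := rfl
    linear_combination C γ * u ^ 2 * (v * vinv + 1) * hvv - (v + C γ * 𝒟c * u) * C γinv * 𝒟cinv ^ 2 * hv -
      C γ * u ^ 2 * (𝒟c * 𝒟cinv) ^ 2 * hCγ - C γ * u ^ 2 * (𝒟c * 𝒟cinv + 1) * h𝒟𝒟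
  refine ⟨?_, ?_⟩
  · show X * d⁄dX A (Λ₂.subst (X * v) * vinv - C ℓ₀ * Λ - C γinv * Cc) -
        (Λ₂.subst (X * v) * vinv - C ℓ₀ * Λ - C γinv * Cc) = _
    have hdC : ∀ (a : A) (f : A⟦X⟧), d⁄dX A (C a * f) = C a * d⁄dX A f := fun a f => by
      rw [Derivation.leibniz, derivative_C, smul_zero, add_zero, smul_eq_mul]
    rw [map_sub, map_sub, hdC, hdC, hℓ]
    simp only [map_add, map_sub, map_mul]
    linear_combination hA - C γinv * C (p : A) * hΛ - C γinv * hHL - W.formalInvDiff * 𝒰 * hstar +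
      C γ * C β₂ * X ^ 2 * W.formalInvDiff * (v * vinv + 1) * hvv
  · have hCc0 : constantCoeff Cc = -(2 * n : A) := by
      rw [hCc, map_mul, clearedDeriv_def, map_mul, W.constantCoeff_formalEta, one_mul, map_sub, map_mul,
        constantCoeff_X, zero_mul, zero_sub, map_mul, map_natCast, h𝒟c0, mul_one, h𝒟cinvdef,
        PowerSeries.constantCoeff_invOfUnit, inv_one, Units.val_one, mul_one]
      push_cast; ring
    show constantCoeff (Λ₂.subst (X * v) * vinv - C ℓ₀ * Λ - C γinv * Cc) = 0
    rw [map_sub, map_sub, map_mul, map_mul, map_mul, constantCoeff_subst_of_constantCoeff_eq_zero hτ0, hΛ₂0,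
      hvinvdef, PowerSeries.constantCoeff_invOfUnit, constantCoeff_C, constantCoeff_C, hΛ0, hCc0, hℓ, ← hγinv, ← hp]
    push_cast; ring

/-! ### Parity: `δ` is odd, hence `δ = η₀·log_E` -/

omit [Algebra ℚ A] in
/-- `(f(-z))' = -f'(-z)`. [folklore] -/
theorem _root_.Literature.NumberTheory.EllipticCurves.rescale_neg_one_derivative (f : A⟦X⟧) :
    rescale (-1 : A) (d⁄dX A f) = -d⁄dX A (rescale (-1 : A) f) := by
  ext n
  rw [coeff_rescale, coeff_derivative, map_neg, coeff_derivative, coeff_rescale, pow_succ]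
  ring

omit [Algebra ℚ A] in
/-- `(f ∘ τ)(az) = f(τ(az))`: rescaling commutes with substitution. [folklore] -/
theorem _root_.Literature.NumberTheory.EllipticCurves.rescale_subst (a : A) (f : A⟦X⟧) {τ : A⟦X⟧}
    (hτ : constantCoeff τ = 0) : rescale a (f.subst τ) = f.subst (rescale a τ) := by
  have hτ' : HasSubst τ := HasSubst.of_constantCoeff_zero' hτ
  rw [rescale_eq_subst, rescale_eq_subst, subst_comp_subst_apply hτ' (HasSubst.smul_X' a)]

omit [Algebra ℚ A] in
/-- **An even series of an odd series is even**: `f(-z) = f(z)`, `τ(-z) = -τ(z)` give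
`f(τ(-z)) = f(τ(z))`. [folklore] -/
theorem _root_.Literature.NumberTheory.EllipticCurves.rescale_neg_one_subst_of_even_of_odd {f τ : A⟦X⟧}
    (hf : rescale (-1 : A) f = f) (hτodd : rescale (-1 : A) τ = -τ) (hτ : constantCoeff τ = 0) :
    rescale (-1 : A) (f.subst τ) = f.subst τ := by
  have hτ' : HasSubst τ := HasSubst.of_constantCoeff_zero' hτ
  rw [rescale_subst _ _ hτ, hτodd]
  conv_rhs => rw [← hf, rescale_eq_subst, subst_comp_subst_apply (HasSubst.smul_X' (-1 : A)) hτ', subst_smul hτ',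
    subst_X hτ', neg_one_smul]

omit [Algebra ℚ A] in
/-- The inverse of an even unit series is even. [folklore] -/
theorem _root_.Literature.NumberTheory.EllipticCurves.rescale_neg_one_invOfUnit_of_even {v : A⟦X⟧} {γu : Aˣ}
    (hv : constantCoeff v = γu) (hev : rescale (-1 : A) v = v) :
    rescale (-1 : A) (v.invOfUnit γu) = v.invOfUnit γu := by
  have h1 : v * v.invOfUnit γu = 1 := PowerSeries.mul_invOfUnit v γu hv
  have h2 : v * rescale (-1 : A) (v.invOfUnit γu) = 1 := by
    have := congrArg (rescale (-1 : A)) h1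
    rwa [map_mul, hev, map_one] at this
  have hvu : IsUnit v := PowerSeries.isUnit_iff_constantCoeff.mpr (by rw [hv]; exact Units.isUnit _)
  exact hvu.mul_left_cancel (h2.trans h1.symm)

/-- **`δ = η₀·log_E`**: from `t(tδ)' - tδ = η₀t²W`, `(tδ)(0) = 0` we get `tδ = t·ε` with
`ε' = η₀ω`, so `ε = η₀ log_E + ε(0)`; and `ε` is ODD (all of `tζ''(τ)`, `tζ`, `t·D log D(x(t))`
are even when `Λ, Λ'', 𝒟, u` are even and `a₁ = a₃ = 0`), so `ε(0) = 0`. (Blakestad–Grant: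
"`δ(t)` … being an odd function of `t`, it must be `0`", once `η = 0`.)
[Blakestad–Grant 2023, proof of Prop. 13] [cite: BlakestadGrant2023, Prop. 13] -/
theorem tdelta_eq_C_mul_X_mul_formalLog [W.IsCharNeTwoNF] [W₂.IsCharNeTwoNF] {γ ℓ₀ β β₂ T' : A} (hγ : IsUnit γ)
    {p n : ℕ} (hp : 2 * n + 1 = p) (hγℓ : γ * ℓ₀ = p) {𝒟c u 𝒰 Λ Λ₂ : A⟦X⟧}
    (h𝒟c0 : constantCoeff 𝒟c = 1) (hu0 : constantCoeff u = 1) (hΛ0 : constantCoeff Λ = 1)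
    (hΛ₂0 : constantCoeff Λ₂ = 1)
    (hΛ : X * d⁄dX A Λ - Λ = -((W.formalXMulSq - C β * X ^ 2) * W.formalInvDiff))
    (hΛ₂ : X * d⁄dX A Λ₂ - Λ₂ = -((W₂.formalXMulSq - C β₂ * X ^ 2) * W₂.formalInvDiff))
    (hV1 : W₂.formalXMulSq.subst (X * (C γ * 𝒟c * u)) = u ^ 2 * 𝒰)
    (hV2 : W₂.formalInvDiff.subst (X * (C γ * 𝒟c * u)) * d⁄dX A (X * (C γ * 𝒟c * u)) = C γ * W.formalInvDiff)
    (hHL : X * d⁄dX A (W.clearedDeriv (2 * n) 𝒟c * 𝒟c.invOfUnit 1) - W.clearedDeriv (2 * n) 𝒟c * 𝒟c.invOfUnit 1 =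
      W.formalInvDiff * (C (p : A) * W.formalXMulSq - C T' * X ^ 2 - 𝒰 * 𝒟c.invOfUnit 1 ^ 2))
    (hΛev : rescale (-1 : A) Λ = Λ) (hΛ₂ev : rescale (-1 : A) Λ₂ = Λ₂) (h𝒟cev : rescale (-1 : A) 𝒟c = 𝒟c)
    (huev : rescale (-1 : A) u = u) :
    let v := C γ * 𝒟c * u
    let tδ := Λ₂.subst (X * v) * v.invOfUnit hγ.unit - C ℓ₀ * Λ -
      C (↑hγ.unit⁻¹ : A) * (W.clearedDeriv (2 * n) 𝒟c * 𝒟c.invOfUnit 1)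
    tδ = C (γ * β₂ - ℓ₀ * β + T' * ↑hγ.unit⁻¹) * X * W.formalLog := by
  intro v tδ
  obtain ⟨hdiff, h0⟩ := W.X_mul_derivative_tdelta_sub W₂ hγ hp hγℓ h𝒟c0 hu0 hΛ0 hΛ₂0 hΛ hΛ₂ hV1 hV2 hHL
  set η₀ := γ * β₂ - ℓ₀ * β + T' * ↑hγ.unit⁻¹ with hη₀
  -- `tδ = X·ε`, `ε' = η₀ω`
  obtain ⟨ε, hε⟩ : (X : A⟦X⟧) ∣ tδ := by rwa [X_dvd_iff]
  have hε' : d⁄dX A ε = C η₀ * W.formalOmega := by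
    apply PowerSeries.X_pow_mul_cancel (k := 2)
    rw [← W.formalInvDiff_eq_formalOmega]
    have h : X * d⁄dX A tδ - tδ = C η₀ * X ^ 2 * W.formalInvDiff := hdiff
    rw [hε, Derivation.leibniz, derivative_X, smul_eq_mul, smul_eq_mul, mul_one] at h
    linear_combination h
  have hεlog := W.eq_C_mul_formalLog_add_of_derivative_eq hε'
  -- parity: `tδ` is even, so `ε` is odd and `ε(0) = 0`
  have hv0 : constantCoeff v = hγ.unit := by
    show constantCoeff (C γ * 𝒟c * u) = _
    rw [map_mul, map_mul, constantCoeff_C, h𝒟c0, hu0, mul_one, mul_one, IsUnit.unit_spec]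
  have hresC : ∀ c : A, rescale (-1 : A) (C c) = C c := fun c => by
    ext m; rw [coeff_rescale, coeff_C]
    split_ifs with hm
    · rw [hm, pow_zero, one_mul]
    · rw [mul_zero]
  have hvev : rescale (-1 : A) v = v := by
    show rescale (-1 : A) (C γ * 𝒟c * u) = C γ * 𝒟c * u
    rw [map_mul, map_mul, hresC, h𝒟cev, huev]
  have hτ0 : constantCoeff (X * v) = 0 := by rw [map_mul, constantCoeff_X, zero_mul]
  have hτodd : rescale (-1 : A) (X * v) = -(X * v) := by
    rw [map_mul, rescale_X, hvev, map_neg, map_one]; ring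
  have htδev : rescale (-1 : A) tδ = tδ := by
    show rescale (-1 : A) (Λ₂.subst (X * v) * v.invOfUnit hγ.unit - C ℓ₀ * Λ -
      C (↑hγ.unit⁻¹ : A) * (W.clearedDeriv (2 * n) 𝒟c * 𝒟c.invOfUnit 1)) = _
    rw [map_sub, map_sub, map_mul, map_mul, map_mul, map_mul, hresC, hresC,
      rescale_neg_one_subst_of_even_of_odd hΛ₂ev hτodd hτ0, rescale_neg_one_invOfUnit_of_even hv0 hvev, hΛev,
      rescale_neg_one_invOfUnit_of_even (by rw [h𝒟c0, Units.val_one]) h𝒟cev, clearedDeriv_def, map_mul,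
      W.rescale_neg_one_formalEta, map_sub, map_mul, map_mul, rescale_X, rescale_neg_one_derivative, h𝒟cev,
      map_natCast, map_neg, map_one]
    congr 2
    rw [clearedDeriv_def]
    ring
  have hεodd : rescale (-1 : A) ε = -ε := by
    apply PowerSeries.X_mul_cancel
    have h := htδev
    rw [hε, map_mul, rescale_X, map_neg, map_one] at h
    linear_combination -h
  have hε0 : constantCoeff ε = 0 := by
    have h := congrArg constantCoeff hεodd
    rw [← coeff_zero_eq_constantCoeff_apply, coeff_rescale, pow_zero, one_mul, map_neg,
      coeff_zero_eq_constantCoeff_apply] at h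
    have h2 : (2 : A) * constantCoeff ε = 0 := by linear_combination h
    have hhalf : algebraMap ℚ A (1 / 2) * 2 = 1 := by
      rw [show (2 : A) = algebraMap ℚ A 2 by rw [map_ofNat], ← map_mul, one_div_mul_cancel two_ne_zero, map_one]
    linear_combination algebraMap ℚ A (1 / 2) * h2 - constantCoeff ε * hhalf
  rw [hε, hεlog, hε0, map_zero, add_zero]
  ring

/-! ### The integral form of `δ` -/

omit [Algebra ℚ A] in
/-- **`δ = ζ̃''(τ) - ℓ₀ζ̃ + (ℓ₀/p)·Du/u`, cleared**: with `tζ̃ = Z₁η` (`tZ₁ = ΛW - 1`, `η = W⁻¹`;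
Blakestad–Grant's integral `ζ̃ = ζ - Dt/t`, Cor. 9) and likewise for `E''`,

  `t·(Z₂(τ)η''(τ) - ℓ₀Z₁η + γ⁻¹·η·u'/u) = tδ`,

because `ζ''(τ) - ζ̃''(τ) = D''τ/τ`, `ζ - ζ̃ = Dt/t` and
`γ⁻¹(D''τ/τ·(ψ^*ω''/ω)⁻¹… ) = γ⁻¹·D log(τ/(t𝒟)) = γ⁻¹·D log(γu)` — the bookkeeping behind
"`D(ζ_{E'}(t') - (H/p)ζ_E(t) - (p/H)Dφ_ψ/φ_ψ) = η`" having an integral left side.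
[Blakestad–Grant 2023, proof of Prop. 13 (integrality of `δ`), Cor. 9]
[cite: BlakestadGrant2023, Prop. 13] -/
theorem X_mul_integralForm_eq_tdelta {γ ℓ₀ : A} (hγ : IsUnit γ) {p n : ℕ} (hp : 2 * n + 1 = p)
    (hγℓ : γ * ℓ₀ = p) {𝒟c u Λ Λ₂ Z₁ Z₂ : A⟦X⟧}
    (h𝒟c0 : constantCoeff 𝒟c = 1) (hu0 : constantCoeff u = 1)
    (hZ₁ : X * Z₁ = Λ * W.formalInvDiff - 1) (hZ₂ : X * Z₂ = Λ₂ * W₂.formalInvDiff - 1)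
    (hV2 : W₂.formalInvDiff.subst (X * (C γ * 𝒟c * u)) * d⁄dX A (X * (C γ * 𝒟c * u)) = C γ * W.formalInvDiff) :
    let v := C γ * 𝒟c * u
    let tδ := Λ₂.subst (X * v) * v.invOfUnit hγ.unit - C ℓ₀ * Λ -
      C (↑hγ.unit⁻¹ : A) * (W.clearedDeriv (2 * n) 𝒟c * 𝒟c.invOfUnit 1)
    X * (Z₂.subst (X * v) * W₂.formalEta.subst (X * v) - C ℓ₀ * Z₁ * W.formalEta +
      C (↑hγ.unit⁻¹ : A) * W.formalEta * d⁄dX A u * u.invOfUnit 1) = tδ := by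
  intro v tδ
  set γinv : A := ↑hγ.unit⁻¹ with hγinv
  set vinv := v.invOfUnit hγ.unit with hvinvdef
  set 𝒟cinv := 𝒟c.invOfUnit 1 with h𝒟cinvdef
  set uinv := u.invOfUnit 1 with huinvdef
  set η := W.formalEta with hη
  have hγγ : γ * γinv = 1 := by rw [hγinv, IsUnit.mul_val_inv]
  have F10 : C γ * C γinv = (1 : A⟦X⟧) := by rw [← map_mul, hγγ, map_one]
  have hℓ : C ℓ₀ = C γinv * (p : A⟦X⟧) := by
    rw [← map_natCast (C (R := A)) p, ← map_mul, ← hγℓ, ← mul_assoc, mul_comm γinv, hγγ, one_mul]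
  have hpcast : (p : A⟦X⟧) = 2 * (n : A⟦X⟧) + 1 := by rw [← hp]; push_cast; ring
  have hv0 : constantCoeff v = hγ.unit := by
    show constantCoeff (C γ * 𝒟c * u) = _
    rw [map_mul, map_mul, constantCoeff_C, h𝒟c0, hu0, mul_one, mul_one, IsUnit.unit_spec]
  have F6 : v * vinv = 1 := PowerSeries.mul_invOfUnit v _ hv0
  have F7 : 𝒟c * 𝒟cinv = 1 := PowerSeries.mul_invOfUnit 𝒟c 1 (by rw [h𝒟c0, Units.val_one])
  have F8 : u * uinv = 1 := PowerSeries.mul_invOfUnit u 1 (by rw [hu0, Units.val_one])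
  have F3 : η * W.formalInvDiff = 1 := W.formalEta_mul_formalInvDiff
  have hτ0 : constantCoeff (X * v) = 0 := by rw [map_mul, constantCoeff_X, zero_mul]
  have hτ : HasSubst (X * v) := HasSubst.of_constantCoeff_zero' hτ0
  set τ := X * v with hτdef
  set L := Λ₂.subst τ
  set Wτ := W₂.formalInvDiff.subst τ
  set ητ := W₂.formalEta.subst τ
  set Zτ := Z₂.subst τ
  have F1 : τ * Zτ = L * Wτ - 1 := by
    have h := congrArg (PowerSeries.subst τ) hZ₂
    rwa [subst_mul hτ, subst_X hτ, subst_sub hτ, subst_mul hτ, ← coe_substAlgHom hτ, map_one,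
      coe_substAlgHom hτ] at h
  have F2 : ητ * Wτ = 1 := by
    have h := congrArg (PowerSeries.subst τ) W₂.formalEta_mul_formalInvDiff
    rwa [subst_mul hτ, ← coe_substAlgHom hτ, map_one, coe_substAlgHom hτ] at h
  have F5 : d⁄dX A τ = v + X * d⁄dX A v := by
    rw [hτdef, Derivation.leibniz, derivative_X, smul_eq_mul, smul_eq_mul, mul_one, add_comm]
  have F9 : d⁄dX A v = C γ * (d⁄dX A 𝒟c * u + 𝒟c * d⁄dX A u) := by
    show d⁄dX A (C γ * 𝒟c * u) = _
    rw [Derivation.leibniz, Derivation.leibniz, derivative_C, smul_zero, add_zero, smul_eq_mul, smul_eq_mul,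
      smul_eq_mul]
    ring
  have F11 : vinv = C γinv * 𝒟cinv * uinv := by
    have hvu : IsUnit v := PowerSeries.isUnit_iff_constantCoeff.mpr (by rw [hv0]; exact Units.isUnit _)
    refine hvu.mul_left_cancel (F6.trans ?_)
    have hv : v = C γ * 𝒟c * u := rfl
    rw [hv]
    linear_combination -(𝒟c * 𝒟cinv) * (u * uinv) * F10 - (u * uinv) * F7 - F8
  -- S2a: `η''(τ) = τ'·η/γ`
  have S2a : ητ = d⁄dX A τ * η * C γinv := by
    linear_combination -(ητ * η * C γinv) * hV2 + d⁄dX A τ * η * C γinv * F2 - ητ * (C γ * C γinv) * F3 - ητ * F10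
  -- S1: `t·Z₂(τ)η''(τ) = L/v - η''(τ)/v`
  have S1 : X * (Zτ * ητ) = L * vinv - vinv * ητ := by
    linear_combination -(X * Zτ * ητ) * F6 + vinv * ητ * F1 + L * vinv * F2
  -- S2: `η''(τ)/v = γ⁻¹η(1 + t𝒟'/𝒟 + tu'/u)`
  have S2 : vinv * ητ = η * C γinv * (1 + X * d⁄dX A 𝒟c * 𝒟cinv + X * d⁄dX A u * uinv) := by
    rw [S2a, F5, F9, F11]
    linear_combination (η * C γinv) * (1 + X * (d⁄dX A 𝒟c * 𝒟cinv * (u * uinv) + d⁄dX A u * uinv * (𝒟c * 𝒟cinv))) * F10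
      + η * C γinv * X * (d⁄dX A 𝒟c * 𝒟cinv) * F8 + η * C γinv * X * (d⁄dX A u * uinv) * F7
      + η * C γinv ^ 2 * C γ * (u * uinv) * F7 + η * C γinv ^ 2 * C γ * F8
  -- S3: `t·ℓ₀Z₁η = ℓ₀(Λ - η)`
  have S3 : X * (C ℓ₀ * Z₁ * η) = C ℓ₀ * (Λ - η) := by
    linear_combination C ℓ₀ * η * hZ₁ + C ℓ₀ * Λ * F3
  show X * (Zτ * ητ - C ℓ₀ * Z₁ * η + C γinv * η * d⁄dX A u * uinv) =
    L * vinv - C ℓ₀ * Λ - C γinv * (W.clearedDeriv (2 * n) 𝒟c * 𝒟cinv)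
  rw [clearedDeriv_def, ← hη, mul_add, mul_sub, S1, S3, S2, hℓ, hpcast]
  push_cast
  linear_combination -(2 * (n : A⟦X⟧)) * C γinv * η * F7

/-! ### `η₀ = 0`: unbounded denominators of `log_E` (Blakestad–Grant's Lemma 4 / eq. (9)) -/

/-- `[z^{m+2}] log_W = ω_{m+1}/(m+2)`. [Silverman AEC IV.5] [folklore] -/
theorem coeff_formalLog_add_two (m : ℕ) :
    coeff (m + 2) W.formalLog = algebraMap ℚ A (1 / (m + 2 : ℚ)) * coeff (m + 1) W.formalOmega := by
  rw [formalLog, coeff_mk]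

/-- **`tδ = 0`** (Blakestad–Grant: `η = 0`, then `δ = 0`): `tδ = η₀·t·log_E`
(`tdelta_eq_C_mul_X_mul_formalLog`) and `tδ = t·ℰ` with `ℰ` having coefficients in a subring `O`
(`X_mul_integralForm_eq_tdelta` + hypothesis `hint`), so `η₀·w_{p^{k+1}-1}/p^{k+1} ∈ O` for all
`k`; the Hasse coefficients `w_{p^{k+1}-1}` being units of `O` and `O` being `p`-adically
separated, `η₀ = 0` ("`c = 0` by Lemma 4": `log_E` does not have bounded denominators).
[Blakestad–Grant 2023, proof of Prop. 13, Lemma 4, Lemma 12] [cite: BlakestadGrant2023, Prop. 13] -/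
theorem tdelta_eq_zero [W.IsCharNeTwoNF] [W₂.IsCharNeTwoNF] {γ ℓ₀ β β₂ T' : A} (hγ : IsUnit γ)
    {p n : ℕ} (hp : 2 * n + 1 = p) (hγℓ : γ * ℓ₀ = p) {𝒟c u 𝒰 Λ Λ₂ Z₁ Z₂ : A⟦X⟧}
    (h𝒟c0 : constantCoeff 𝒟c = 1) (hu0 : constantCoeff u = 1) (hΛ0 : constantCoeff Λ = 1)
    (hΛ₂0 : constantCoeff Λ₂ = 1)
    (hΛ : X * d⁄dX A Λ - Λ = -((W.formalXMulSq - C β * X ^ 2) * W.formalInvDiff))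
    (hΛ₂ : X * d⁄dX A Λ₂ - Λ₂ = -((W₂.formalXMulSq - C β₂ * X ^ 2) * W₂.formalInvDiff))
    (hV1 : W₂.formalXMulSq.subst (X * (C γ * 𝒟c * u)) = u ^ 2 * 𝒰)
    (hV2 : W₂.formalInvDiff.subst (X * (C γ * 𝒟c * u)) * d⁄dX A (X * (C γ * 𝒟c * u)) = C γ * W.formalInvDiff)
    (hHL : X * d⁄dX A (W.clearedDeriv (2 * n) 𝒟c * 𝒟c.invOfUnit 1) - W.clearedDeriv (2 * n) 𝒟c * 𝒟c.invOfUnit 1 =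
      W.formalInvDiff * (C (p : A) * W.formalXMulSq - C T' * X ^ 2 - 𝒰 * 𝒟c.invOfUnit 1 ^ 2))
    (hΛev : rescale (-1 : A) Λ = Λ) (hΛ₂ev : rescale (-1 : A) Λ₂ = Λ₂) (h𝒟cev : rescale (-1 : A) 𝒟c = 𝒟c)
    (huev : rescale (-1 : A) u = u)
    (hZ₁ : X * Z₁ = Λ * W.formalInvDiff - 1) (hZ₂ : X * Z₂ = Λ₂ * W₂.formalInvDiff - 1)
    {O : Type*} [CommRing O] (ι : O →+* A) (hι : Function.Injective ι)
    (hint : ∃ E₀ : O⟦X⟧, E₀.map ι = Z₂.subst (X * (C γ * 𝒟c * u)) * W₂.formalEta.subst (X * (C γ * 𝒟c * u)) -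
      C ℓ₀ * Z₁ * W.formalEta + C (↑hγ.unit⁻¹ : A) * W.formalEta * d⁄dX A u * u.invOfUnit 1)
    (hw : ∀ k : ℕ, ∃ w : Oˣ, ι w = coeff (p ^ (k + 1) - 1) W.formalInvDiff)
    (hsep : ∀ x : O, (∀ k : ℕ, (p : O) ^ k ∣ x) → x = 0) (h1p : 2 ≤ p) :
    let v := C γ * 𝒟c * u
    Λ₂.subst (X * v) * v.invOfUnit hγ.unit - C ℓ₀ * Λ -
      C (↑hγ.unit⁻¹ : A) * (W.clearedDeriv (2 * n) 𝒟c * 𝒟c.invOfUnit 1) = 0 := by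
  intro v
  have hlog := W.tdelta_eq_C_mul_X_mul_formalLog W₂ hγ hp hγℓ h𝒟c0 hu0 hΛ0 hΛ₂0 hΛ hΛ₂ hV1 hV2 hHL hΛev hΛ₂ev
    h𝒟cev huev
  have hintf := W.X_mul_integralForm_eq_tdelta W₂ hγ hp hγℓ h𝒟c0 hu0 hZ₁ hZ₂ hV2
  dsimp only at hlog hintf
  obtain ⟨E₀, hE₀⟩ := hint
  set η₀ := γ * β₂ - ℓ₀ * β + T' * ↑hγ.unit⁻¹ with hη₀
  -- `E₀ = η₀·log_E`
  have hE : E₀.map ι = C η₀ * W.formalLog := by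
    apply PowerSeries.X_mul_cancel
    rw [hE₀, hintf, hlog]; ring
  -- `η₀ = ι(p^{k+1}·e_k·w_k⁻¹)` for every `k`
  have hk : ∀ k : ℕ, ∃ x : O, η₀ = ι ((p : O) ^ (k + 1) * x) := by
    intro k
    obtain ⟨w, hwk⟩ := hw k
    obtain ⟨M, hM⟩ : ∃ M : ℕ, p ^ (k + 1) = M + 2 := by
      have h2 : 2 ≤ p ^ (k + 1) :=
        le_trans h1p (by simpa only [pow_one] using Nat.pow_le_pow_right (by omega : 1 ≤ p) (by omega : 1 ≤ k + 1))
      exact ⟨p ^ (k + 1) - 2, by omega⟩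
    have hm := congrArg (coeff (M + 2)) hE
    rw [coeff_map, coeff_C_mul, coeff_formalLog_add_two, ← W.formalInvDiff_eq_formalOmega,
      show M + 1 = p ^ (k + 1) - 1 by omega, ← hwk] at hm
    have hq : algebraMap ℚ A (1 / (M + 2 : ℚ)) * ((M : A) + 2) = 1 := by
      rw [show ((M : A) + 2) = algebraMap ℚ A (M + 2 : ℚ) by rw [map_add, map_natCast, map_ofNat], ← map_mul,
        one_div_mul_cancel (by positivity), map_one]
    have hwinv : ι w * ι (↑w⁻¹ : O) = 1 := by rw [← map_mul, Units.mul_inv, map_one]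
    have hcast : ι ((p : O) ^ (k + 1)) = (M : A) + 2 := by
      rw [map_pow, map_natCast, ← Nat.cast_pow, hM]; push_cast; ring
    refine ⟨coeff (M + 2) E₀ * ↑w⁻¹, ?_⟩
    calc η₀ = η₀ * (algebraMap ℚ A (1 / (M + 2 : ℚ)) * ((M : A) + 2)) * (ι w * ι (↑w⁻¹ : O)) := by
          rw [hq, hwinv, mul_one, mul_one]
      _ = ((M : A) + 2) * (η₀ * (algebraMap ℚ A (1 / (M + 2 : ℚ)) * ι w)) * ι (↑w⁻¹ : O) := by ring
      _ = ((M : A) + 2) * ι (coeff (M + 2) E₀) * ι (↑w⁻¹ : O) := by rw [← hm]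
      _ = ι ((p : O) ^ (k + 1) * (coeff (M + 2) E₀ * ↑w⁻¹)) := by rw [map_mul, map_mul, hcast]; ring
  -- hence `η₀ ∈ ⋂ p^k O = 0`
  obtain ⟨x₀, hx₀⟩ := hk 0
  have hy : (p : O) ^ (0 + 1) * x₀ = 0 := by
    refine hsep _ fun k => ?_
    obtain ⟨x, hx⟩ := hk k
    rw [hι (hx₀.symm.trans hx)]
    exact Dvd.dvd.mul_right (pow_dvd_pow _ (Nat.le_succ k)) _
  have hη : η₀ = 0 := by rw [hx₀, hy, map_zero]
  show subst (X * (C γ * 𝒟c * u)) Λ₂ * (C γ * 𝒟c * u).invOfUnit hγ.unit - C ℓ₀ * Λ -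
      C (↑hγ.unit⁻¹ : A) * (W.clearedDeriv (2 * n) 𝒟c * 𝒟c.invOfUnit 1) = 0
  rw [hlog, hη, map_zero, zero_mul, zero_mul]

/-! ### The functional equation -/

/-- **Blakestad–Grant's Prop. 13 (functional equation of `g = ∫ζ̃ω` along the canonical-type
isogeny), cleared power-series form.** Under the hypotheses of `tdelta_eq_zero` — two short curves
`E, E''` over a `ℚ`-algebra with zeta data `(β, Λ)`, `(β'', Λ'')` (Blakestad–Grant Thm. 2), the
formal isogeny `τ = γ·t·𝒟·u` with (V1) `X''(τ) = u²𝒰`, (V2) `W''(τ)τ' = γW`, (HL) the summed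
Lemma 10, parity, and integrality over a `p`-adically separated `O` with unit Hasse
coefficients — one has, for `g = W.sigmaExpArg Λ`, `g'' = W''.sigmaExpArg Λ''`,

  `d/dt (p·g - g''∘τ) = u'/u`  and  `(p·g - g''∘τ)(0) = 0`,

i.e. `g(t) - p⁻¹g''(t') = p⁻¹ log u(t)` (Prop. 13(b); part (a) is `tdelta_eq_zero`).
[Blakestad–Grant 2023, Prop. 13] [cite: BlakestadGrant2023, Prop. 13] -/
theorem derivative_functionalEquation [W.IsCharNeTwoNF] [W₂.IsCharNeTwoNF] {γ ℓ₀ β β₂ T' : A}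
    (hγ : IsUnit γ) {p n : ℕ} (hp : 2 * n + 1 = p) (hγℓ : γ * ℓ₀ = p) {𝒟c u 𝒰 Λ Λ₂ Z₁ Z₂ : A⟦X⟧}
    (h𝒟c0 : constantCoeff 𝒟c = 1) (hu0 : constantCoeff u = 1) (hΛ0 : constantCoeff Λ = 1)
    (hΛ₂0 : constantCoeff Λ₂ = 1)
    (hΛ : X * d⁄dX A Λ - Λ = -((W.formalXMulSq - C β * X ^ 2) * W.formalInvDiff))
    (hΛ₂ : X * d⁄dX A Λ₂ - Λ₂ = -((W₂.formalXMulSq - C β₂ * X ^ 2) * W₂.formalInvDiff))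
    (hV1 : W₂.formalXMulSq.subst (X * (C γ * 𝒟c * u)) = u ^ 2 * 𝒰)
    (hV2 : W₂.formalInvDiff.subst (X * (C γ * 𝒟c * u)) * d⁄dX A (X * (C γ * 𝒟c * u)) = C γ * W.formalInvDiff)
    (hHL : X * d⁄dX A (W.clearedDeriv (2 * n) 𝒟c * 𝒟c.invOfUnit 1) - W.clearedDeriv (2 * n) 𝒟c * 𝒟c.invOfUnit 1 =
      W.formalInvDiff * (C (p : A) * W.formalXMulSq - C T' * X ^ 2 - 𝒰 * 𝒟c.invOfUnit 1 ^ 2))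
    (hΛev : rescale (-1 : A) Λ = Λ) (hΛ₂ev : rescale (-1 : A) Λ₂ = Λ₂) (h𝒟cev : rescale (-1 : A) 𝒟c = 𝒟c)
    (huev : rescale (-1 : A) u = u)
    (hZ₁ : X * Z₁ = Λ * W.formalInvDiff - 1) (hZ₂ : X * Z₂ = Λ₂ * W₂.formalInvDiff - 1)
    {O : Type*} [CommRing O] (ι : O →+* A) (hι : Function.Injective ι)
    (hint : ∃ E₀ : O⟦X⟧, E₀.map ι = Z₂.subst (X * (C γ * 𝒟c * u)) * W₂.formalEta.subst (X * (C γ * 𝒟c * u)) -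
      C ℓ₀ * Z₁ * W.formalEta + C (↑hγ.unit⁻¹ : A) * W.formalEta * d⁄dX A u * u.invOfUnit 1)
    (hw : ∀ k : ℕ, ∃ w : Oˣ, ι w = coeff (p ^ (k + 1) - 1) W.formalInvDiff)
    (hsep : ∀ x : O, (∀ k : ℕ, (p : O) ^ k ∣ x) → x = 0) (h1p : 2 ≤ p) :
    d⁄dX A (C (p : A) * W.sigmaExpArg Λ - (W₂.sigmaExpArg Λ₂).subst (X * (C γ * 𝒟c * u))) =
        d⁄dX A u * u.invOfUnit 1 ∧
      constantCoeff (C (p : A) * W.sigmaExpArg Λ - (W₂.sigmaExpArg Λ₂).subst (X * (C γ * 𝒟c * u))) = 0 := by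
  have h0 := W.tdelta_eq_zero W₂ hγ hp hγℓ h𝒟c0 hu0 hΛ0 hΛ₂0 hΛ hΛ₂ hV1 hV2 hHL hΛev hΛ₂ev h𝒟cev huev hZ₁ hZ₂ ι hι
    hint hw hsep h1p
  dsimp only at h0
  set v := C γ * 𝒟c * u with hv
  set γinv : A := ↑hγ.unit⁻¹ with hγinv
  set vinv := v.invOfUnit hγ.unit with hvinvdef
  set 𝒟cinv := 𝒟c.invOfUnit 1 with h𝒟cinvdef
  set uinv := u.invOfUnit 1 with huinvdef
  set η := W.formalEta with hη
  have hγγ : γ * γinv = 1 := by rw [hγinv, IsUnit.mul_val_inv]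
  have F10 : C γ * C γinv = (1 : A⟦X⟧) := by rw [← map_mul, hγγ, map_one]
  have hγℓ' : C γ * C ℓ₀ = C (p : A) := by rw [← map_mul, hγℓ]
  have hpcast : C (p : A) = 2 * (n : A⟦X⟧) + 1 := by rw [map_natCast, ← hp]; push_cast; ring
  have hv0 : constantCoeff v = hγ.unit := by
    rw [hv, map_mul, map_mul, constantCoeff_C, h𝒟c0, hu0, mul_one, mul_one, IsUnit.unit_spec]
  have F6 : v * vinv = 1 := PowerSeries.mul_invOfUnit v _ hv0
  have F7 : 𝒟c * 𝒟cinv = 1 := PowerSeries.mul_invOfUnit 𝒟c 1 (by rw [h𝒟c0, Units.val_one])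
  have F8 : u * uinv = 1 := PowerSeries.mul_invOfUnit u 1 (by rw [hu0, Units.val_one])
  have F3 : η * W.formalInvDiff = 1 := W.formalEta_mul_formalInvDiff
  have hτ0 : constantCoeff (X * v) = 0 := by rw [map_mul, constantCoeff_X, zero_mul]
  have hτ : HasSubst (X * v) := HasSubst.of_constantCoeff_zero' hτ0
  set τ := X * v with hτdef
  set L := Λ₂.subst τ
  set Wτ := W₂.formalInvDiff.subst τ
  set G := (W₂.sigmaExpArg Λ₂).subst τ with hG
  set Gp := (d⁄dX A (W₂.sigmaExpArg Λ₂)).subst τ with hGp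
  have hg : X * d⁄dX A (W.sigmaExpArg Λ) = Λ * W.formalInvDiff - 1 := by
    rw [W.formalInvDiff_eq_formalOmega]; exact X_mul_derivative_sigmaExpArg hΛ0
  have E1 : τ * Gp - (L * Wτ - 1) = 0 := by
    have h := congrArg (PowerSeries.subst τ) (X_mul_derivative_sigmaExpArg (W := W₂) hΛ₂0)
    rw [← W₂.formalInvDiff_eq_formalOmega, subst_mul hτ, subst_X hτ, subst_sub hτ, subst_mul hτ,
      ← coe_substAlgHom hτ, map_one, coe_substAlgHom hτ] at h
    rw [h, sub_self]
  have C1 : d⁄dX A G = Gp * d⁄dX A τ := derivative_subst A hτ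
  have F5 : d⁄dX A τ = v + X * d⁄dX A v := by
    rw [hτdef, Derivation.leibniz, derivative_X, smul_eq_mul, smul_eq_mul, mul_one, add_comm]
  have F9 : d⁄dX A v = C γ * (d⁄dX A 𝒟c * u + 𝒟c * d⁄dX A u) := by
    rw [hv, Derivation.leibniz, Derivation.leibniz, derivative_C, smul_zero, add_zero, smul_eq_mul, smul_eq_mul,
      smul_eq_mul]
    ring
  have F11 : vinv = C γinv * 𝒟cinv * uinv := by
    have hvu : IsUnit v := PowerSeries.isUnit_iff_constantCoeff.mpr (by rw [hv0]; exact Units.isUnit _)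
    refine hvu.mul_left_cancel (F6.trans ?_)
    rw [hv]
    linear_combination -(𝒟c * 𝒟cinv) * (u * uinv) * F10 - (u * uinv) * F7 - F8
  -- G1: `t·(g''∘τ)' = (LW''(τ) - 1)·τ'/v`
  have G1 : X * d⁄dX A G = (L * Wτ - 1) * vinv * d⁄dX A τ := by
    rw [C1]
    linear_combination vinv * d⁄dX A τ * E1 - Gp * d⁄dX A τ * X * F6
  -- G2: `τ'/v = 1 + t𝒟'/𝒟 + tu'/u`
  have G2 : vinv * d⁄dX A τ = 1 + X * (d⁄dX A 𝒟c * 𝒟cinv + d⁄dX A u * uinv) := by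
    rw [F5, F9, F11]
    linear_combination (1 + X * (d⁄dX A 𝒟c * 𝒟cinv * (u * uinv) + d⁄dX A u * uinv * (𝒟c * 𝒟cinv))) * F10
      + X * (d⁄dX A 𝒟c * 𝒟cinv) * F8 + X * (d⁄dX A u * uinv) * F7
      + C γinv * C γ * (u * uinv) * F7 + C γinv * C γ * F8
  refine ⟨?_, ?_⟩
  · apply PowerSeries.X_mul_cancel
    have hdC : ∀ (a : A) (f : A⟦X⟧), d⁄dX A (C a * f) = C a * d⁄dX A f := fun a f => by
      rw [Derivation.leibniz, derivative_C, smul_zero, add_zero, smul_eq_mul]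
    rw [map_sub, hdC, mul_sub, ← mul_assoc, mul_comm X (C (p : A)), mul_assoc, hg, G1]
    rw [clearedDeriv_def, ← hη] at h0
    push_cast at h0
    rw [hpcast] at hγℓ' ⊢
    linear_combination -(L * vinv) * hV2 + G2 - (C γ * W.formalInvDiff) * h0 - (Λ * W.formalInvDiff) * hγℓ' -
      (η * W.formalInvDiff) * (X * d⁄dX A 𝒟c * 𝒟cinv - 2 * (n : A⟦X⟧) * 𝒟c * 𝒟cinv) * F10 -
      (X * d⁄dX A 𝒟c * 𝒟cinv - 2 * (n : A⟦X⟧) * 𝒟c * 𝒟cinv) * F3 + 2 * (n : A⟦X⟧) * F7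
  · rw [map_sub, map_mul, constantCoeff_sigmaExpArg, mul_zero, hG,
      constantCoeff_subst_of_constantCoeff_eq_zero hτ0, constantCoeff_sigmaExpArg, sub_zero]

end Delta

end WeierstrassCurve
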